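import Summits.CriticalPhenomena.CardyFormulaZ2.Theorems.CardySelfDualSegmentUniformMarginalityDefs
import Summits.CriticalPhenomena.CardyFormulaZ2.Theorems.CardySelfDualSegmentUniformMarginalityStubPextContinuous
import Summits.CriticalPhenomena.CardyFormulaZ2.Theorems.CardyIKTransportCrudeToCanonical
import Summits.CriticalPhenomena.CardyFormulaZ2.Theorems.CardySelfDualSegmentSmirnovBasePoint
import Literature.Probability.Percolation.BoxCrossingJordan
import Literature.Probability.RandomPlanarGeometry.SLESixCrossingNondegenerate
import Literature.Probability.RandomPlanarGeometry.ConformalRectangleProofs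

/-!
# Disproof of `UniformMarginality` (stmt-CriticalPhenomena-5472) — findings of the crux disprover

Crux (route `CardySelfDualSegment`, sub-problem `CardyFormulaZ2`, rank 3; decl
`Summit.CriticalPhenomena.CardyFormulaZ2.Theses.CardySelfDualSegment.UniformMarginality`, "UM"):
for every `t₀ ∈ [0,1]`, every conformal rectangle `R` and `ε > 0` there is `η > 0` with
`|P_t(R,δ) − P_{t₀}(R,δ)| < ε` for all `t`, `dist t t₀ < η`, and ALL meshes `δ > 0`, where
`P_t(R,δ) = cornerCrossingProb t R δ` is the crude crossing probability (`embDomainCrossing`: open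
lattice path with all VERTICES in the open carrier, edges unrestricted, endpoints within `2δ` of
`R.arc 0` / `R.arc 2`) of the self-dual corner family `M_t = cornerPercolation t` drawn on `√2 ℤ²`.

## Findings (cycle 1, 2026-08-16; cdisprove seat `refuter-cdisprove-stmt-CriticalPhenomena-5472-0`)

**No kill.** UM survives every cheap attack below. LANDED as negative lemmas (all accepted, no sorry,
nothing defined): I `Theorems/UniformMarginality/Negative/ShapeUniformity.lean` (p103031),
II `…/Negative/EndpointTightness.lean` (p106300), III `…/Negative/BasePointLimit.lean` (p106772);
this work file is SELF-CONTAINED (it re-proves their content under `…Cruxes.UniformMarginality.Disproof`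
so that it elaborates on any farm snapshot), keeps the one `sorry` (`combDictionary_holds`, a geometric
bookkeeping statement) and the prose.

* §1 `crux_iff_integratedBound` (proved): the crux is LITERALLY the line's `HeatFlow.IntegratedBound`.
* §2 LOAD-BEARING ANALYSIS (proved, I): UM has no hypothesis to drop; its single quantitative feature is
  the quantifier order `∃ η, ∀ δ`. The swapped statement (continuity in `t` at each FIXED mesh) is a
  THEOREM (`Negative.cornerCrossingProb_continuous_in_parameter`, from the landed stub
  `stub_pextContinuous`). So mesh-uniformity is the whole content, and only `δ → 0` matters (at
  `δ ≥ δ₀` the crude event is one of finitely many cylinder events on `{‖y‖ ≤ diam R/(δ₀√2)}`: finitely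
  many polynomials).
* §3 REFUTED NATURAL STRENGTHENING — uniformity in the rectangle (I): `UniformMarginalityUniformInR`
  (`∃ η` BEFORE `∀ R`) is false modulo the COMB DICTIONARY `CombDictionary` (§3c; checked by exact
  computation, not formalised): for all `N, H` a polygonal slit rectangle — the single-scale comb
  `R_{X,R}` = `(0,X) × (0,R+½)` minus thin closed strips along the anti-diagonals `x + y = 3i+2`, hung
  on the RIGHT side (arc 1) by sub-lattice threads and risers — has crude `M_t`-crossing probability at
  mesh `1/√2` EXACTLY `combProb N H t = 1 − (1 − ½(½ − t/4)^H)^N` (`H = R − 2`; the site set is a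
  disjoint union of induced anti-diagonal ZIGZAGS, start = row 1, end = row `R`; a zigzag is open iff
  its `H` corner vertices have BOTH corner edges open — probability `½ − t/4`, the only `t`-dependent
  local statistic of `M_t` — plus one north edge). With `N = 2^{H+1}`: `combProb ≥ ½` at `t = 0`
  (`Negative.half_le_combProb_zero`) and `≤ (1 − t/2)^H` (`Negative.combProb_le`), so no `η` serves all
  combs (`Negative.comb_gap`, `Negative.comb_not_equicontinuous`, `Negative.not_shapeUniform_of_combDictionary`).
  Evidence on the item: `comb_check.py` + output (exact rational agreement for
  `(X,R) ∈ {(9,3),(12,4),(15,5),(30,6),(40,10)}`, all `t ∈ {0,¼,½,¾,1}`; brute-force corner-law check).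
  CONSEQUENCE FOR PROVERS: `η(t₀,R,ε)` in UM — and `C(R,t₀)` in the line's `RussoBound` — is not a
  function of the conformal modulus of `R` (nor of finitely many conformal invariants): it sees the
  LATTICE-SCALE geometry of `∂R` (the comb's Russo sum at mesh `1/√2`, `t = 0`, is `≈ −0.09·H`). A
  proof must localise the Russo census away from `∂R` with boundary terms controlled for arbitrary
  Jordan boundaries, or run on tame rectangles and transport.
* §4a TIGHTNESS AT BOTH ENDPOINTS (proved, II + III): for EVERY conformal rectangle `R` —
  wild Jordan boundaries included — `∃ c > 0`, eventually as `δ → 0⁺`: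
  `c ≤ bondDomainCrossingProb R δ ≤ 1 − c`, `c ≤ cornerCrossingProb 1 R δ`
  (`Negative.cornerCrossingProb_one_eventually_ge`: RSW corollary + G02 ⊆ crude + `cornerPercolation_one`)
  and `c ≤ cornerCrossingProb 0 R δ ≤ 1 − c`; better, AT `t = 0` THE CRUDE PROBABILITIES CONVERGE,
  `cornerCrossingProb 0 R δ → L(R) = F(η(φ_ζ R)) ∈ (0,1)` (`Negative.cornerCrossingProb_zero_tendsto`:
  the tree's proof of `SmirnovBasePoint` + uniformizing data + `cardyFunction_mem_Ioo`).
* §4b KILL CRITERION AT THE BASE POINT (proved, III): UM ⇒ JOINT convergence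
  `cornerCrossingProb t R δ → L(R)` as `(t,δ) → (0,0⁺)` (`Negative.jointLimit_at_zero_of_uniformMarginality`).
  So ¬UM at `t₀ = 0` ⇔ some `R` and `(t_k, δ_k) → (0, 0⁺)` with `P_{t_k}(R, δ_k) ↛ F(η(φ_ζ R))`:
  UM at the Smirnov point IS the perturbative stability of Smirnov's theorem under the corner
  deformation, uniformly in how slowly `t_k → 0` relative to `δ_k`. (The route's SegmentOpen then asks
  for the identification of the `t_k > 0` limits as sheared Cardy values — a different statement.)
* §4c WHY THE CRUX RESISTS (prose, near-miss): the multi-scale comb — the only candidate found for an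
  outright counterexample inside ONE Jordan domain — does not close (slack / Jordan attachment /
  eventual tightness / compounding tolls; §4a forbids its `t = 1` and `t = 0` versions outright: a
  stacked comb would force `P_1(R*,δ_k) ≤ N_k ½ ¼^{H_k} → 0`). Entropy wall for rigorous bounds at
  `t ∉ {0,1}`. VERDICT: UM as stated is not cheaply false; on tame `R` it is universality folklore,
  consistent with the line's numerics (signed Russo sum `≤ 0.1`, `L = 8…256`, kit j015475/j015527).
* §5 LINE `Sketch` (lead prover-line-stmt-CriticalPhenomena-5472-0): no stuck stubs handed over.
  `RussoIdentity` re-derived (sign `(1 − 2c_v)`, factor `½ = d(t/2)/dt`, integrand independent of the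
  flipped bit, `K ⊆ verts` by `not_isPivotal_northEdge`: correct); `PextContinuous` landed;
  `RussoBound` is the research stub — §3 shows its constant is not shape-uniform but does not refute
  it (for a FIXED comb only finitely many polynomials occur at `δ ≥ 1/√2`); §4b says that at `t₀ = 0`
  the integrated target is "P_t(R,δ) → F(η(φ_ζR)) jointly".
-/


noncomputable section

namespace Summit.CriticalPhenomena.CardyFormulaZ2.Cruxes.UniformMarginality.Disproof

open MeasureTheory Filter Topology Set
open Literature.Probability.Percolation Literature.Probability.LatticeModels
  Literature.Probability.RandomPlanarGeometry Literature.Barriers.CriticalPhenomena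
open Summit.CriticalPhenomena.CardyFormulaZ2.Cruxes.UniformMarginality.HeatFlow
open Summit.CriticalPhenomena.CardyFormulaZ2.Theses.CardySelfDualSegment (UniformMarginality)
open Summit.CriticalPhenomena.CardyFormulaZ2.Theorems (bondDomainCrossingProb_le_crude)
open Summit.CriticalPhenomena.CardyFormulaZ2.Cruxes.SmirnovBasePoint.ShearedSandwich
  (hasCrossingLimit_shear tendsto_sqrt_two_mul sqrt_two_mul_div_sqrt_two')

/-! ## Landed content, re-proved here (I `ShapeUniformity`, II `EndpointTightness`, III `BasePointLimit`) -/

/-! ### The crux and the line's integrated bound -/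

/-- UM implies the line's `IntegratedBound` (converse of the tree's
`uniformMarginality_of_integratedBound`): `P t R δ = cornerCrossingProb t R δ = Pext R δ t` and
`dist t t₀ = |t − t₀|` on `unitInterval`. [folklore] -/
theorem integratedBound_of_uniformMarginality
    (h : Summit.CriticalPhenomena.CardyFormulaZ2.Theses.CardySelfDualSegment.UniformMarginality) :
    IntegratedBound := by
  intro R t₀ ht₀ ε hε
  obtain ⟨η, hη, hmain⟩ := h ⟨t₀, ht₀⟩ R ε hε
  refine ⟨η, hη, fun δ hδ t ht htt₀ => ?_⟩
  have key := hmain ⟨t, ht⟩ (by rw [Subtype.dist_eq, Real.dist_eq]; exact htt₀) δ hδ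
  have e1 : Pext R δ t = cornerCrossingProb ⟨t, ht⟩ R δ := Pext_coe R δ ⟨t, ht⟩
  have e2 : Pext R δ t₀ = cornerCrossingProb ⟨t₀, ht₀⟩ R δ := Pext_coe R δ ⟨t₀, ht₀⟩
  rw [e1, e2]
  exact key

/-! ### Positive control: continuity in the parameter at every fixed mesh -/

/-- **UM without mesh-uniformity holds**: for every `t₀`, `R`, `ε > 0` and every FIXED mesh
`δ > 0` there is `η > 0` with `|P_t(R,δ) − P_{t₀}(R,δ)| < ε` whenever `dist t t₀ < η` — continuity of
the cylinder polynomial `Pext R δ` (`stub_pextContinuous`). The crux is this statement with `η`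
uniform in `δ`. [folklore] -/
theorem cornerCrossingProb_continuous_in_parameter (t₀ : unitInterval) (R : ConformalRectangle)
    {ε : ℝ} (hε : 0 < ε) {δ : ℝ} (hδ : 0 < δ) :
    ∃ η > 0, ∀ t : unitInterval, dist t t₀ < η →
      |cornerCrossingProb t R δ - cornerCrossingProb t₀ R δ| < ε := by
  have hc : Continuous (Pext R δ) := stub_pextContinuous R δ hδ
  obtain ⟨η, hη, h⟩ := Metric.continuous_iff.1 hc (t₀ : ℝ) ε hε
  refine ⟨η, hη, fun t ht => ?_⟩
  have hd : dist (t : ℝ) (t₀ : ℝ) < η := by rwa [← Subtype.dist_eq]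
  have key := h (t : ℝ) hd
  rw [Real.dist_eq, Pext_coe, Pext_coe] at key
  exact key

/-! ### The comb amplification inequality -/

/-! Throughout, `combProb N H t := 1 − (1 − ½ (½ − t/4)^H)^N` (the crossing probability of `N`
disjoint forced zigzags with `H` corners each) is written out explicitly — nothing is defined. -/

/-- Union (Bernoulli) bound: `combProb N H t ≤ N · ½ (½ − t/4)^H` for `t ∈ [0, 1]`. [folklore] -/
theorem combProb_le (N H : ℕ) {t : ℝ} (ht0 : 0 ≤ t) (ht1 : t ≤ 1) :
    (1 - (1 - (1 / 2 : ℝ) * (1 / 2 - t / 4) ^ H) ^ N) ≤ N * ((1 / 2 : ℝ) * (1 / 2 - t / 4) ^ H) := by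
  set x : ℝ := (1 / 2 : ℝ) * (1 / 2 - t / 4) ^ H with hx
  have hb : (0 : ℝ) ≤ 1 / 2 - t / 4 := by linarith
  have hx0 : 0 ≤ x := mul_nonneg (by norm_num) (pow_nonneg hb H)
  have hb1 : (1 / 2 - t / 4 : ℝ) ≤ 1 := by linarith
  have hpow : (1 / 2 - t / 4 : ℝ) ^ H ≤ 1 := pow_le_one₀ hb hb1
  have hx2 : x ≤ 1 / 2 := by rw [hx]; linarith
  have hB := one_add_mul_le_pow (show (-2 : ℝ) ≤ -x by linarith) N
  have h1 : (1 : ℝ) + -x = 1 - x := by ring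
  have h2 : (N : ℝ) * -x = -((N : ℝ) * x) := by ring
  rw [h1, h2] at hB
  linarith

/-- At `t = 0` with `N = 2^{H+1}` zigzags the comb is crossed with probability at least `½`, for
EVERY `H`: `(1 − 2^{−(H+1)})^{2^{H+1}} ≤ e^{−1} < ½`. [folklore] -/
theorem half_le_combProb_zero (H : ℕ) :
    (1 / 2 : ℝ) ≤ (1 - (1 - (1 / 2 : ℝ) * (1 / 2 - 0 / 4) ^ H) ^ (2 ^ (H + 1))) := by
  have hx : (1 / 2 : ℝ) * (1 / 2 - 0 / 4) ^ H = (1 / 2) ^ (H + 1) := by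
    rw [zero_div, sub_zero, pow_succ']
  rw [hx]
  set x : ℝ := (1 / 2 : ℝ) ^ (H + 1) with hxdef
  have hx0 : 0 < x := by positivity
  have hx1 : x ≤ 1 / 2 := by
    have : ((1 : ℝ) / 2) ^ H ≤ 1 := pow_le_one₀ (by norm_num) (by norm_num)
    rw [hxdef, pow_succ']
    linarith
  have hNx : (2 : ℝ) ^ (H + 1) * x = 1 := by rw [hxdef, ← mul_pow]; norm_num
  have h1 : (1 - x) ^ (2 ^ (H + 1)) ≤ Real.exp (-x) ^ (2 ^ (H + 1)) :=
    pow_le_pow_left₀ (by linarith) (Real.one_sub_le_exp_neg x) _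
  have h2 : Real.exp (-x) ^ (2 ^ (H + 1)) = Real.exp (-1) := by
    rw [← Real.exp_nat_mul]
    congr 1
    push_cast
    rw [mul_neg, hNx]
  have h3 : Real.exp (-1) ≤ 1 / 2 := by
    have he : (2 : ℝ) < Real.exp 1 := lt_trans (by norm_num) Real.exp_one_gt_d9
    have hpos : 0 < Real.exp (-1) := Real.exp_pos _
    have hmul : Real.exp (-1) * Real.exp 1 = 1 := by rw [← Real.exp_add]; norm_num
    nlinarith
  rw [h2] at h1
  linarith

/-- **Amplification gap**: for `t ∈ [0,1]` with `(1 − t/2)^H ≤ ¼`,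
`combProb(2^{H+1}, H, 0) − combProb(2^{H+1}, H, t) ≥ ¼` (indeed `combProb(2^{H+1}, H, t) ≤ (1 − t/2)^H`).
[folklore] -/
theorem comb_gap (H : ℕ) {t : ℝ} (ht0 : 0 ≤ t) (ht1 : t ≤ 1) (hH : (1 - t / 2) ^ H ≤ 1 / 4) :
    1 / 4 ≤ (1 - (1 - (1 / 2 : ℝ) * (1 / 2 - 0 / 4) ^ H) ^ (2 ^ (H + 1)))
      - (1 - (1 - (1 / 2 : ℝ) * (1 / 2 - t / 4) ^ H) ^ (2 ^ (H + 1))) := by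
  have hup := combProb_le (2 ^ (H + 1)) H ht0 ht1
  have hid : ((2 ^ (H + 1) : ℕ) : ℝ) * ((1 / 2 : ℝ) * (1 / 2 - t / 4) ^ H) = (1 - t / 2) ^ H := by
    push_cast
    have hq : (1 / 2 - t / 4 : ℝ) = 1 / 2 * (1 - t / 2) := by ring
    rw [hq, mul_pow]
    have h2 : (2 : ℝ) ^ (H + 1) * ((1 / 2) * (1 / 2) ^ H) = 1 := by
      rw [← pow_succ', ← mul_pow]; norm_num
    calc (2 : ℝ) ^ (H + 1) * (1 / 2 * ((1 / 2) ^ H * (1 - t / 2) ^ H))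
        = ((2 : ℝ) ^ (H + 1) * ((1 / 2) * (1 / 2) ^ H)) * (1 - t / 2) ^ H := by ring
      _ = (1 - t / 2) ^ H := by rw [h2, one_mul]
  have hlow := half_le_combProb_zero H
  rw [hid] at hup
  linarith

/-- **The comb family is not equicontinuous at `t = 0`**: no single `η` serves all combs.
[folklore] -/
theorem comb_not_equicontinuous :
    ¬ ∀ ε > (0 : ℝ), ∃ η > (0 : ℝ), ∀ (N H : ℕ) (t : ℝ), 0 ≤ t → t ≤ 1 → t < η →
        |(1 - (1 - (1 / 2 : ℝ) * (1 / 2 - t / 4) ^ H) ^ N)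
          - (1 - (1 - (1 / 2 : ℝ) * (1 / 2 - 0 / 4) ^ H) ^ N)| < ε := by
  intro h
  obtain ⟨η, hη, hmain⟩ := h (1 / 4) (by norm_num)
  set t : ℝ := min (η / 2) 1 with ht
  have ht0 : 0 < t := lt_min (by linarith) one_pos
  have ht1 : t ≤ 1 := min_le_right _ _
  have htη : t < η := lt_of_le_of_lt (min_le_left _ _) (by linarith)
  obtain ⟨H, hH⟩ := exists_pow_lt_of_lt_one (show (0 : ℝ) < 1 / 4 by norm_num)
    (show (1 - t / 2 : ℝ) < 1 by linarith)
  have hgap := comb_gap H ht0.le ht1 hH.le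
  have habs := hmain (2 ^ (H + 1)) H t ht0.le ht1 htη
  rw [abs_lt] at habs
  linarith [habs.1, habs.2]

/-! ### No shape-uniform modulus of continuity, modulo the comb dictionary -/

/-- **¬(shape-uniform marginality), modulo the comb dictionary.** If every abstract comb is realised
— for all `N, H` some conformal rectangle `R` and mesh `δ > 0` have
`cornerCrossingProb t R δ = combProb N H t` for all `t` (the explicit slit rectangles `R_{X,R}` of
`Cruxes/UniformMarginality/Disproof.lean` do this at `δ = 1/√2`; checked there by exact computation)
— then the strengthening of the crux with `∃ η` in front of `∀ R` is false. [folklore] -/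
theorem not_shapeUniform_of_combDictionary
    (hD : ∀ N H : ℕ, ∃ (R : ConformalRectangle) (δ : ℝ), 0 < δ ∧
      ∀ t : unitInterval, cornerCrossingProb t R δ = (1 - (1 - (1 / 2 : ℝ) * (1 / 2 - (t : ℝ) / 4) ^ H) ^ N)) :
    ¬ ∀ (t₀ : unitInterval) (ε : ℝ), 0 < ε → ∃ η > 0, ∀ (R : ConformalRectangle) (t : unitInterval),
        dist t t₀ < η → ∀ δ : ℝ, 0 < δ →
          |cornerCrossingProb t R δ - cornerCrossingProb t₀ R δ| < ε := by
  intro h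
  apply comb_not_equicontinuous
  intro ε hε
  obtain ⟨η, hη, hmain⟩ := h 0 ε hε
  refine ⟨η, hη, fun N H t ht0 ht1 htη => ?_⟩
  obtain ⟨R, δ, hδ, hR⟩ := hD N H
  have hdist : dist (⟨t, ⟨ht0, ht1⟩⟩ : unitInterval) 0 < η := by
    rw [Subtype.dist_eq, Real.dist_eq]
    simpa [abs_of_nonneg ht0] using htη
  have key := hmain R ⟨t, ⟨ht0, ht1⟩⟩ hdist δ hδ
  rw [hR, hR] at key
  simpa using key


/-- **Eventual RSW lower bound for G02 crossings of a conformal rectangle**: some `c > 0` bounds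
`bondDomainCrossingProb R δ` from below for all small `δ > 0` (else `0` would be a cluster point at
`0⁺`, contradicting `discreteCrossingProb_clusterPt_mem_Ioo_holds`). [folklore] -/
theorem bondDomainCrossingProb_eventually_ge (R : ConformalRectangle) :
    ∃ c > 0, ∀ᶠ δ in 𝓝[>] (0 : ℝ), c ≤ bondDomainCrossingProb R δ := by
  by_contra hneg
  have h0 : MapClusterPt (0 : ℝ) (𝓝[>] (0 : ℝ))
      (fun δ => discreteCrossingProb half R.carrier δ (R.arc 0) (R.arc 2)) := by
    rw [mapClusterPt_iff_frequently]
    intro s hs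
    obtain ⟨ε, hε, hball⟩ := Metric.mem_nhds_iff.1 hs
    have hfr : ∃ᶠ δ in 𝓝[>] (0 : ℝ), ¬ ε ≤ bondDomainCrossingProb R δ :=
      Filter.not_eventually.1 fun h => hneg ⟨ε, hε, h⟩
    refine hfr.mono fun δ hδ => hball ?_
    have hnn : 0 ≤ bondDomainCrossingProb R δ := by
      rw [bondDomainCrossingProb_eq_measureReal]; exact measureReal_nonneg
    rw [Metric.mem_ball, Real.dist_eq, sub_zero]
    show |bondDomainCrossingProb R δ| < ε
    rw [abs_of_nonneg hnn]
    exact lt_of_not_ge hδ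
  exact lt_irrefl (0 : ℝ) (discreteCrossingProb_clusterPt_mem_Ioo_holds R h0).1

/-- **Eventual RSW upper bound for G02 crossings of a conformal rectangle**: some `c > 0` has
`bondDomainCrossingProb R δ ≤ 1 − c` for all small `δ > 0`. [folklore] -/
theorem bondDomainCrossingProb_eventually_le (R : ConformalRectangle) :
    ∃ c > 0, ∀ᶠ δ in 𝓝[>] (0 : ℝ), bondDomainCrossingProb R δ ≤ 1 - c := by
  by_contra hneg
  have h1 : MapClusterPt (1 : ℝ) (𝓝[>] (0 : ℝ))
      (fun δ => discreteCrossingProb half R.carrier δ (R.arc 0) (R.arc 2)) := by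
    rw [mapClusterPt_iff_frequently]
    intro s hs
    obtain ⟨ε, hε, hball⟩ := Metric.mem_nhds_iff.1 hs
    have hfr : ∃ᶠ δ in 𝓝[>] (0 : ℝ), ¬ bondDomainCrossingProb R δ ≤ 1 - ε :=
      Filter.not_eventually.1 fun h => hneg ⟨ε, hε, h⟩
    refine hfr.mono fun δ hδ => hball ?_
    have hle : bondDomainCrossingProb R δ ≤ 1 := by
      rw [bondDomainCrossingProb_eq_measureReal]; exact measureReal_le_one
    rw [Metric.mem_ball, Real.dist_eq]
    show |bondDomainCrossingProb R δ - 1| < ε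
    rw [abs_sub_comm, abs_of_nonneg (by linarith)]
    have := lt_of_not_ge hδ
    linarith
  exact lt_irrefl (1 : ℝ) (discreteCrossingProb_clusterPt_mem_Ioo_holds R h1).2

/-- **Tightness of the crux's crossing probabilities at the endpoint `t = 1`**: for every conformal
rectangle `R` there is `c > 0` with `c ≤ cornerCrossingProb 1 R δ` for all small `δ > 0` —
`M_1` is bond percolation at `½` (`cornerPercolation_one`), a G02 crossing at mesh `√2 δ` is a crude
crossing at mesh `δ` (`bondDomainCrossingProb_le_crude`), and G02 crossings obey the eventual RSW
lower bound. No Jordan boundary, however wild, forces all crude `M_1`-crossings through vanishing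
bottlenecks. [folklore] -/
theorem cornerCrossingProb_one_eventually_ge (R : ConformalRectangle) :
    ∃ c > 0, ∀ᶠ δ in 𝓝[>] (0 : ℝ), c ≤ cornerCrossingProb 1 R δ := by
  obtain ⟨c, hc, hev⟩ := bondDomainCrossingProb_eventually_ge R
  refine ⟨c, hc, ?_⟩
  -- `δ ↦ √2 δ` maps `δ → 0⁺` to `δ → 0⁺` (as in `ShearedSandwich.tendsto_sqrt_two_mul`)
  have htend : Tendsto (fun δ : ℝ => Real.sqrt 2 * δ) (𝓝[>] 0) (𝓝[>] 0) := by
    refine tendsto_nhdsWithin_iff.2 ⟨?_, ?_⟩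
    · have h : Tendsto (fun δ : ℝ => Real.sqrt 2 * δ) (𝓝 0) (𝓝 (Real.sqrt 2 * 0)) :=
        tendsto_id.const_mul _
      rw [mul_zero] at h
      exact h.mono_left nhdsWithin_le_nhds
    · filter_upwards [self_mem_nhdsWithin] with δ hδ
      exact mul_pos (Real.sqrt_pos.2 two_pos) hδ
  filter_upwards [htend.eventually hev, self_mem_nhdsWithin] with δ hδ hpos
  have h2 : (0 : ℝ) < Real.sqrt 2 := Real.sqrt_pos.2 two_pos
  have hle := bondDomainCrossingProb_le_crude R (δ := Real.sqrt 2 * δ) (mul_pos h2 hpos)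
  rw [mul_div_cancel_left₀ δ h2.ne'] at hle
  rw [cornerCrossingProb_eq, cornerPercolation_one]
  exact hδ.trans hle


/-- **At `t = 0` the crude crossing probabilities converge, for every conformal rectangle**, to a
limit in `(0, 1)` (Cardy's value of the sheared rectangle `φ_ζ R`). [cite: Smirnov2001, Thm. 1] -/
theorem cornerCrossingProb_zero_tendsto (R : ConformalRectangle) :
    ∃ L ∈ Ioo (0 : ℝ) 1, Tendsto (cornerCrossingProb 0 R) (𝓝[>] 0) (𝓝 L) := by
  set S : ConformalRectangle :=
    R.map (shearHomeomorph triZeta Literature.Probability.Percolation.triZeta_im_ne_zero)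
  obtain ⟨φ, x, hφ⟩ := MarkedDomain.exists_isUniformizing_holds S
  refine ⟨Literature.Probability.RandomPlanarGeometry.cardyFunction (crossRatio x),
    cardyFunction_mem_Ioo (ConformalRectangle.crossRatio_mem_Ioo_of_isUniformizing hφ), ?_⟩
  have h := (hasCrossingLimit_shear R φ x hφ).comp tendsto_sqrt_two_mul
  refine h.congr fun δ => ?_
  simp only [Function.comp_apply, sqrt_two_mul_div_sqrt_two']

/-- **Tightness at the Smirnov point `t = 0`**: for every conformal rectangle `R` there is `c > 0`
with `c ≤ cornerCrossingProb 0 R δ ≤ 1 − c` for all small `δ > 0`. [folklore] -/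
theorem cornerCrossingProb_zero_eventually_mem (R : ConformalRectangle) :
    ∃ c > 0, ∀ᶠ δ in 𝓝[>] (0 : ℝ),
      c ≤ cornerCrossingProb 0 R δ ∧ cornerCrossingProb 0 R δ ≤ 1 - c := by
  obtain ⟨L, hL, hlim⟩ := cornerCrossingProb_zero_tendsto R
  set c : ℝ := min L (1 - L) / 2 with hc
  have hcpos : 0 < c := by
    have : 0 < min L (1 - L) := lt_min hL.1 (by linarith [hL.2])
    rw [hc]; linarith
  refine ⟨c, hcpos, ?_⟩
  have hlo : ∀ᶠ δ in 𝓝[>] (0 : ℝ), c < cornerCrossingProb 0 R δ :=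
    (tendsto_order.1 hlim).1 c (by
      have := min_le_left L (1 - L); rw [hc]; linarith [hL.1])
  have hhi : ∀ᶠ δ in 𝓝[>] (0 : ℝ), cornerCrossingProb 0 R δ < 1 - c :=
    (tendsto_order.1 hlim).2 (1 - c) (by
      have := min_le_right L (1 - L); rw [hc]; linarith [hL.2])
  filter_upwards [hlo, hhi] with δ h1 h2
  exact ⟨h1.le, h2.le⟩

/-- **Kill criterion at the base point.** `UniformMarginality` implies JOINT convergence at
`(t, δ) = (0, 0⁺)`: for every conformal rectangle `R` there is `L ∈ (0,1)` (the limit of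
`cornerCrossingProb 0 R δ`) such that for every `ε > 0` there are `η > 0` and `δ₀ > 0` with
`|cornerCrossingProb t R δ − L| < ε` whenever `dist t 0 < η` and `0 < δ < δ₀`. [folklore] -/
theorem jointLimit_at_zero_of_uniformMarginality
    (h : Summit.CriticalPhenomena.CardyFormulaZ2.Theses.CardySelfDualSegment.UniformMarginality)
    (R : ConformalRectangle) :
    ∃ L ∈ Ioo (0 : ℝ) 1, Tendsto (cornerCrossingProb 0 R) (𝓝[>] 0) (𝓝 L) ∧
      ∀ ε > 0, ∃ η > 0, ∃ δ₀ > 0, ∀ t : unitInterval, dist t 0 < η →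
        ∀ δ : ℝ, 0 < δ → δ < δ₀ → |cornerCrossingProb t R δ - L| < ε := by
  obtain ⟨L, hL, hlim⟩ := cornerCrossingProb_zero_tendsto R
  refine ⟨L, hL, hlim, fun ε hε => ?_⟩
  -- UM at `t₀ = 0` with `ε/2`
  obtain ⟨η, hη, hUM⟩ := h 0 R (ε / 2) (by linarith)
  -- convergence at `t = 0` with `ε/2`
  have hev : ∀ᶠ δ in 𝓝[>] (0 : ℝ), dist (cornerCrossingProb 0 R δ) L < ε / 2 :=
    Metric.tendsto_nhds.1 hlim (ε / 2) (by linarith)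
  rw [eventually_nhdsWithin_iff, Metric.eventually_nhds_iff] at hev
  obtain ⟨δ₀, hδ₀, hball⟩ := hev
  refine ⟨η, hη, δ₀, hδ₀, fun t ht δ hδ hδδ₀ => ?_⟩
  have h1 : |cornerCrossingProb t R δ - cornerCrossingProb 0 R δ| < ε / 2 := hUM t ht δ hδ
  have h2 : dist (cornerCrossingProb 0 R δ) L < ε / 2 :=
    hball (by rw [Real.dist_eq, sub_zero, abs_of_pos hδ]; exact hδδ₀) hδ
  rw [Real.dist_eq] at h2
  calc |cornerCrossingProb t R δ - L|
      = |(cornerCrossingProb t R δ - cornerCrossingProb 0 R δ) + (cornerCrossingProb 0 R δ - L)| := by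
        ring_nf
    _ ≤ |cornerCrossingProb t R δ - cornerCrossingProb 0 R δ| + |cornerCrossingProb 0 R δ - L| :=
        abs_add_le _ _
    _ < ε := by linarith


/-! ## §1 The crux is exactly `HeatFlow.IntegratedBound` -/

/-- **The crux is literally `IntegratedBound`** (→ is `integratedBound_of_uniformMarginality` below, landed; ← is the tree's `uniformMarginality_of_integratedBound`). -/
theorem crux_iff_integratedBound : UniformMarginality ↔ IntegratedBound :=
  ⟨integratedBound_of_uniformMarginality, uniformMarginality_of_integratedBound⟩

/-! ## §2 Load-bearing analysis: mesh-uniformity is the whole content -/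

/-- The crux with `∃ η` and `∀ δ` EXCHANGED: continuity of `t ↦ P_t(R, δ)` at `t₀` for each fixed
mesh. (UM is this plus uniformity of `η` in `δ`.) -/
def UniformMarginalityWithoutMeshUniformity : Prop :=
  ∀ (t₀ : unitInterval) (R : ConformalRectangle) (ε : ℝ), 0 < ε → ∀ δ : ℝ, 0 < δ →
    ∃ η > 0, ∀ t : unitInterval, dist t t₀ < η →
      |cornerCrossingProb t R δ - cornerCrossingProb t₀ R δ| < ε

/-- **Positive control (proved, landed): without mesh-uniformity the crux holds.** Hence there is
no `_false_without_` lemma for this crux: its only droppable feature, once dropped, leaves a theorem. -/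
theorem withoutMeshUniformity_holds : UniformMarginalityWithoutMeshUniformity :=
  fun t₀ R _ε hε _δ hδ => cornerCrossingProb_continuous_in_parameter t₀ R hε hδ

/-- UM trivially implies the fixed-mesh statement (the converse direction is the whole crux). -/
theorem withoutMeshUniformity_of_crux (h : UniformMarginality) :
    UniformMarginalityWithoutMeshUniformity := by
  intro t₀ R ε hε δ hδ
  obtain ⟨η, hη, hmain⟩ := h t₀ R ε hε
  exact ⟨η, hη, fun t ht => hmain t ht δ hδ⟩

/-! ## §3 A refuted strengthening: the modulus of continuity cannot be uniform in the rectangle -/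

/-- **Crossing probability of the comb** with `N` complete zigzags of `H` corners:
`combProb N H t = 1 − (1 − ½ (½ − t/4)^H)^N` (written out in the landed file I). -/
def combProb (N H : ℕ) (t : ℝ) : ℝ :=
  1 - (1 - (1 / 2 : ℝ) * (1 / 2 - t / 4) ^ H) ^ N

/-- Amplification gap in the named form (`comb_gap` above is the landed, written-out form): `combProb(2^{H+1},H,0) − combProb(2^{H+1},H,t) ≥ ¼`
once `(1 − t/2)^H ≤ ¼`. -/
theorem comb_gap' (H : ℕ) {t : ℝ} (ht0 : 0 ≤ t) (ht1 : t ≤ 1) (hH : (1 - t / 2) ^ H ≤ 1 / 4) :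
    1 / 4 ≤ combProb (2 ^ (H + 1)) H 0 - combProb (2 ^ (H + 1)) H t :=
  comb_gap H ht0 ht1 hH

/-- The **R-uniform strengthening** of the crux: one `η(t₀, ε)` for ALL conformal rectangles. -/
def UniformMarginalityUniformInR : Prop :=
  ∀ (t₀ : unitInterval) (ε : ℝ), 0 < ε → ∃ η > 0, ∀ (R : ConformalRectangle) (t : unitInterval),
    dist t t₀ < η → ∀ δ : ℝ, 0 < δ → |cornerCrossingProb t R δ - cornerCrossingProb t₀ R δ| < ε

/-- The strengthening does imply the crux (quantifier bookkeeping). -/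
theorem crux_of_uniformInR (h : UniformMarginalityUniformInR) : UniformMarginality := by
  apply uniformMarginality_of_integratedBound
  intro R t₀ ht₀ ε hε
  obtain ⟨η, hη, hmain⟩ := h ⟨t₀, ht₀⟩ ε hε
  refine ⟨η, hη, fun δ hδ t ht htt₀ => ?_⟩
  have key := hmain R ⟨t, ht⟩ (by rw [Subtype.dist_eq, Real.dist_eq]; exact htt₀) δ hδ
  have e1 : Pext R δ t = cornerCrossingProb ⟨t, ht⟩ R δ := Pext_coe R δ ⟨t, ht⟩
  have e2 : Pext R δ t₀ = cornerCrossingProb ⟨t₀, ht₀⟩ R δ := Pext_coe R δ ⟨t₀, ht₀⟩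
  rw [e1, e2]
  exact key

/-- **The comb dictionary**: for all `N, H` some conformal rectangle and mesh realise `combProb N H`
as the crude `M_t`-crossing probability, for every `t`. -/
def CombDictionary : Prop :=
  ∀ N H : ℕ, ∃ (R : ConformalRectangle) (δ : ℝ), 0 < δ ∧
    ∀ t : unitInterval, cornerCrossingProb t R δ = combProb N H t

/-- **¬(R-uniform marginality), modulo the comb dictionary** (`not_shapeUniform_of_combDictionary` above, landed). -/
theorem not_uniformInR_of_combDictionary (hD : CombDictionary) : ¬ UniformMarginalityUniformInR :=
  not_shapeUniform_of_combDictionary hD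

/-- NEAR-MISS (not formalised; checked by exact computation, evidence `comb_check.py` /
`comb_check_output.txt` on the item): **the comb dictionary holds.** Construction: lattice `ℤ²` at
mesh `δ = 1/√2` (`δ · squareLatticeEmbedding.z (a,b) = a + bi`, slack `2δ = √2`); carrier =
`(0, X) × (0, R + ½)` minus, for each `i`, the closed strip
`{|x + y − (3i+2)| ≤ 1/10, 0.3 ≤ x ≤ X − 0.3, ½ ≤ y ≤ R + 0.2}` (it contains exactly the sites
`(a,b)`, `a + b = 3i + 2`, `1 ≤ a ≤ X−1`, `1 ≤ b ≤ R`), a riser `{x = 3i + 3/2} × [y_i, ½]` and a thread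
`[3i + 3/2, X] × {y_i}` of tiny width with `0 < y_0 < y_1 < ⋯ < ½` (longer threads lower, so no two
pieces of hardware meet; strips clipped by `x = X − 0.3` are threaded horizontally at their non-integer
foot height instead); marks `(0,0), (X,0), (X,R+½), (0,R+½)`. The hardware hangs on arc 1, so
arc 0 = bottom side, arc 2 = top side, start set = row 1, end set = row `R`; the sites of the carrier
are `{a + b ≢ 2 (mod 3)}`, whose induced `ℤ²`-graph is the disjoint union of the zigzags on the pairs of
anti-diagonals `{3i, 3i+1}`; zigzag `i` joins row 1 (`v₁ = (3i−1, 1)`, leaf `(3i, 1)`) to row `R` iff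
`3i − R + 1 ≥ 1` and `3i − 1 ≤ X − 1`, through `north(v₁)` and both corner edges of
`v_r = (3i − r, r)`, `2 ≤ r ≤ R − 1` (`H = R − 2` corners); `N = 0` is realised by a small disc
avoiding the lattice. Missing in Lean: the `JordanDomain` structure of this slit rectangle (continuous
injective boundary loop with `range = frontier`) and the unfolding of `embDomainCrossing` on it —
bookkeeping, no conceptual step. -/
theorem combDictionary_holds : CombDictionary := by
  sorry

/-- Hence — modulo `combDictionary_holds` — the R-uniform strengthening of the crux is FALSE. -/
theorem not_uniformInR : ¬ UniformMarginalityUniformInR :=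
  not_uniformInR_of_combDictionary combDictionary_holds

/-! ## §4a/§4b Named corollaries -/

/-- **`t = 1`**: crude `M_1`-crossings of every conformal rectangle are eventually `≥ c(R) > 0`. -/
theorem tight_one (R : ConformalRectangle) :
    ∃ c > 0, ∀ᶠ δ in 𝓝[>] (0 : ℝ), c ≤ cornerCrossingProb 1 R δ :=
  cornerCrossingProb_one_eventually_ge R

/-- **`t = 0`**: crude `M_0`-crossings of every conformal rectangle CONVERGE to a limit in `(0,1)`. -/
theorem limit_zero (R : ConformalRectangle) :
    ∃ L ∈ Set.Ioo (0 : ℝ) 1, Tendsto (cornerCrossingProb 0 R) (𝓝[>] 0) (𝓝 L) :=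
  cornerCrossingProb_zero_tendsto R

/-- **UM ⇒ joint convergence at `(t, δ) = (0, 0⁺)`** (kill criterion at the base point). -/
theorem jointLimit_at_zero (h : UniformMarginality) (R : ConformalRectangle) :
    ∃ L ∈ Set.Ioo (0 : ℝ) 1, Tendsto (cornerCrossingProb 0 R) (𝓝[>] 0) (𝓝 L) ∧
      ∀ ε > 0, ∃ η > 0, ∃ δ₀ > 0, ∀ t : unitInterval, dist t 0 < η →
        ∀ δ : ℝ, 0 < δ → δ < δ₀ → |cornerCrossingProb t R δ - L| < ε :=
  jointLimit_at_zero_of_uniformMarginality h R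

/-! ## §4c Why the crux resists: the multi-scale comb does not close (near-miss, prose)

Target: `¬ UM` at `t₀ = 0` (or `1`), i.e. ONE conformal rectangle `R*`, meshes `δ_k → 0` and
`t_k → t₀` with `|P_{t_k}(R*, δ_k) − P_{t₀}(R*, δ_k)| ≥ ε`. Plan: stack combs of generations
`k = 1, 2, …` (mesh `δ_k`, `H_k → ∞` corners, `N_k ≈ 2^{H_k} δ_k^{-1/3}` zigzags to pay the boundary
one-arm cost of the exits) inside one Jordan domain, generation `k` invisible to coarser meshes (its
hardware sits between their lattice rows: edges of the crude event may leave the carrier) and harmless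
to finer ones. Heuristically (site-𝕋 arm exponents at `t = 0`, universality of exponents for `t > 0`)
generation `k` alone gives `P_0(δ_k) ≥ c` and `P_t(δ_k) ≲ (1 − t/2)^{H_k} → 0` for each fixed `t > 0`
— a violation. It fails for four reasons that look structural:
1. SLACK. The `2δ` endpoint slack puts every lattice neighbour of a deleted site within `2δ` of the
   deleting hardware; so hardware on arc 0 (resp. arc 2) turns zigzag TOPS (resp. bottoms) into start
   (resp. end) points and short-circuits the forcing. Hardware must lie on arcs 1/3.
2. JORDAN. `ConformalRectangle` = `JordanDomain` + marks: the complement is connected and the boundary a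
   simple loop, so every piece of hardware is attached to arc 1 or arc 3 by positive-width threads with
   horizontal extent (no islands, no zero-width slits: `injOn_boundary`).
3. EVENTUAL TIGHTNESS. A set with non-empty interior contains sites of all sufficiently fine meshes and
   a strip of width `τ` is a tight wall at every mesh `≪ τ`; so generation-`k` bands (parallel walls of
   length/spacing ratio `H_k → ∞`, toll `e^{-cH_k}` through their fat corridors) and their attachment
   shelves (toll `(gate width)^{2/3}` around their ends) obstruct ALL finer generations.
4. FIXED ε. A fixed `ε` needs the generation-`k` signal region (the span of its exits) macroscopic for
   infinitely many `k` (disjoint sub-arcs `I_k` give signal `≈ |I_k|^{1/3} → 0`), so generations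
   overlap and finer ones must cross coarser hardware: the tolls of item 3 compound and
   `P_{t₀}(R*, δ_k) → 0` as well. Side-by-side, gated, hierarchical and "finer-bands-higher" layouts
   were tried; each ends in compounding tolls or a shrinking signal.
§4a makes items 3–4 rigorous at the endpoints: `P_1(R, δ_k)` and `P_0(R, δ_k)` are eventually `≥ c(R)`
for EVERY `R`, so no Jordan boundary forces all crude crossings through vanishing bottlenecks, and by
§4b a counterexample at `t₀ = 0` must instead keep `P_{t_k}(R, δ_k)` away from the honest limit
`F(η(φ_ζ R))` — a bulk phenomenon, i.e. the failure of perturbative universality itself.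
ENTROPY WALL (for rigorous statements at `t ∉ {0, 1}`): with only the union bound at `t` (no arm
estimates for `M_t`, `0 < t < 1` — cf. crux `UniformBoxCrossing`) a forced pattern of `H ≤ C log₂(1/δ)`
corners (entropy) distinguishes `t` from `t₀` only when `H |t − t₀| / 2 ≳ κ ln(1/δ)` (`κ = 1/3`, the
boundary one-arm cost of the exits), i.e. `|t − t₀| ≳ 2κ ln 2 / (2 − κ) ≈ 0.28`: nothing rigorous is
available near `t₀` by elementary means — that is where the crux lives.
-/

end Summit.CriticalPhenomena.CardyFormulaZ2.Cruxes.UniformMarginality.Disproof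

end
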